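import Literature.AlgebraicGeometry.Frobenioids.Categories
import Mathlib.CategoryTheory.Discrete.Basic
import Mathlib.CategoryTheory.CodiscreteCategory
import Mathlib.CategoryTheory.Functor.Const
import Mathlib.CategoryTheory.SingleObj
import Mathlib.CategoryTheory.Whiskering
import HarnessLib

/-!
# Frobenioids I, §0: `1`-commutative and `0`-commutative squares, one-object categories — kernel
# status of the FACT-LIST rows F-0965 `OneCommutes`, F-0966 `ZeroCommutes`, F-2309 `IsOneObject`

Mochizuki, *The geometry of Frobenioids I: the general theory*, Kyushu J. Math. **62** (2008)
293–400, §0 "Categories", kurims p. 13 ("We shall refer to a category with precisely one object as a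
*one-object category*") and p. 15 ("we shall say that a diagram of functors *1-commutes* if the
various composite functors in question are isomorphic; when such a diagram 'literally commutes' we
shall say that it *0-commutes*")
[cite: MochizukiFrdI2008, §0 p.13] [cite: MochizukiFrdI2008, §0 p.15].

PROOF-ONLY companion of `Categories.lean` (cell abc-iut, block F fact-proving wave, seat
abc-iut-f-026, tranche 26; rows F-0965 / F-0966 / F-2309 of `plan/FACT-LIST.md`).  The three
declarations are DEFINITIONS of print's vocabulary (predicates with parameters), not assertions, so
the kernel record for each row is, per R5:

* the UNIVERSAL CLOSURE IS REFUTED at a toy instance — `not_oneCommutes_const_false_true`,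
  `not_zeroCommutes_const_false_true`, `not_isOneObject_pempty`, `not_isOneObject_bool` (two
  distinct constant functors into the two-object discrete category; the empty and the two-object
  discrete categories), packaged as `not_forall_oneCommutes` / `not_forall_zeroCommutes` /
  `not_forall_isOneObject`;
* CLOSED INSTANCE WITNESSES (non-vacuity): the reflexive square, the squares with identity sides,
  transposition, invariance under isomorphism of functors, pre/post-composition, inversion along
  equivalences and horizontal / vertical PASTING of `1`-commutative squares (the calculus every
  consumer of `OneCommutes` re-derives by hand), the same for `0`-commutativity, and
  "`1`-commutes ⇏ `0`-commutes" (`oneCommutes_not_zeroCommutes`, target `Codiscrete Bool`);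
  `IsOneObject` / `IsOneMorphism` at the terminal category `Discrete PUnit` and at Mathlib's
  one-object category `SingleObj M` of a monoid, with the characterisations
  `isOneObject_iff_nonempty_unique : IsOneObject C ↔ Nonempty (Unique C)` and
  `isOneMorphism_singleObj_iff : IsOneMorphism (SingleObj M) ↔ Subsingleton M`.

Nothing here re-types a statement of the paper; no bearing on [IUTchIII] Cor. 3.12 (a FACT row is an
assumption label, not an endorsement; typed ≠ proved).
-/

namespace Literature.AlgebraicGeometry.Frobenioids

open CategoryTheory

universe w v v₁ v₂ v₃ v₄ v₅ v₆ u u₁ u₂ u₃ u₄ u₅ u₆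

/-! ### The calculus of `1`- and `0`-commutative squares (p. 15) -/

section Squares

variable {C₁ : Type u₁} [Category.{v₁} C₁] {C₂ : Type u₂} [Category.{v₂} C₂]
  {C₃ : Type u₃} [Category.{v₃} C₃] {C₄ : Type u₄} [Category.{v₄} C₄]
  {C₅ : Type u₅} [Category.{v₅} C₅] {C₆ : Type u₆} [Category.{v₆} C₆]

/-- Unfolding: the square `(F, G; H, K)` `1`-commutes iff `F ⋙ G ≅ H ⋙ K` is inhabited.
[cite: MochizukiFrdI2008, §0 p.15] -/
theorem oneCommutes_iff (F : C₁ ⥤ C₂) (G : C₂ ⥤ C₄) (H : C₁ ⥤ C₃) (K : C₃ ⥤ C₄) :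
    OneCommutes F G H K ↔ Nonempty (F ⋙ G ≅ H ⋙ K) :=
  Iff.rfl

/-- Unfolding: the square `(F, G; H, K)` `0`-commutes iff `F ⋙ G = H ⋙ K` on the nose.
[cite: MochizukiFrdI2008, §0 p.15] -/
theorem zeroCommutes_iff (F : C₁ ⥤ C₂) (G : C₂ ⥤ C₄) (H : C₁ ⥤ C₃) (K : C₃ ⥤ C₄) :
    ZeroCommutes F G H K ↔ F ⋙ G = H ⋙ K :=
  Iff.rfl

/-- The degenerate square `(F, G; F, G)` `0`-commutes. [cite: MochizukiFrdI2008, §0 p.15] -/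
theorem zeroCommutes_refl (F : C₁ ⥤ C₂) (G : C₂ ⥤ C₄) : ZeroCommutes F G F G :=
  rfl

/-- The degenerate square `(F, G; F, G)` `1`-commutes. [cite: MochizukiFrdI2008, §0 p.15] -/
theorem oneCommutes_refl (F : C₁ ⥤ C₂) (G : C₂ ⥤ C₄) : OneCommutes F G F G :=
  (zeroCommutes_refl F G).oneCommutes

/-- The square with `F` on top and bottom and identity vertical sides `0`-commutes:
`F ⋙ 𝟭 = 𝟭 ⋙ F`. [cite: MochizukiFrdI2008, §0 p.15] -/
theorem zeroCommutes_id_sides (F : C₁ ⥤ C₂) : ZeroCommutes F (𝟭 C₂) (𝟭 C₁) F :=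
  rfl

/-- The square with `F` on top and bottom and identity vertical sides `1`-commutes.
[cite: MochizukiFrdI2008, §0 p.15] -/
theorem oneCommutes_id_sides (F : C₁ ⥤ C₂) : OneCommutes F (𝟭 C₂) (𝟭 C₁) F :=
  (zeroCommutes_id_sides F).oneCommutes

/-- The square with identity top and bottom and `F` on both vertical sides `0`-commutes:
`𝟭 ⋙ F = F ⋙ 𝟭`. [cite: MochizukiFrdI2008, §0 p.15] -/
theorem zeroCommutes_id_ends (F : C₁ ⥤ C₂) : ZeroCommutes (𝟭 C₁) F F (𝟭 C₂) :=
  rfl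

/-- The square with identity top and bottom and `F` on both vertical sides `1`-commutes.
[cite: MochizukiFrdI2008, §0 p.15] -/
theorem oneCommutes_id_ends (F : C₁ ⥤ C₂) : OneCommutes (𝟭 C₁) F F (𝟭 C₂) :=
  (zeroCommutes_id_ends F).oneCommutes

/-- Transposition: `0`-commutativity of `(F, G; H, K)` is `0`-commutativity of `(H, K; F, G)`.
[cite: MochizukiFrdI2008, §0 p.15] -/
theorem ZeroCommutes.symm {F : C₁ ⥤ C₂} {G : C₂ ⥤ C₄} {H : C₁ ⥤ C₃} {K : C₃ ⥤ C₄}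
    (h : ZeroCommutes F G H K) : ZeroCommutes H K F G :=
  Eq.symm h

/-- Transposition: `1`-commutativity of `(F, G; H, K)` is `1`-commutativity of `(H, K; F, G)`.
[cite: MochizukiFrdI2008, §0 p.15] -/
theorem OneCommutes.symm {F : C₁ ⥤ C₂} {G : C₂ ⥤ C₄} {H : C₁ ⥤ C₃} {K : C₃ ⥤ C₄}
    (h : OneCommutes F G H K) : OneCommutes H K F G :=
  ⟨h.some.symm⟩

/-- `1`-commutativity is symmetric in the two composites. [cite: MochizukiFrdI2008, §0 p.15] -/
theorem oneCommutes_comm (F : C₁ ⥤ C₂) (G : C₂ ⥤ C₄) (H : C₁ ⥤ C₃) (K : C₃ ⥤ C₄) :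
    OneCommutes F G H K ↔ OneCommutes H K F G :=
  ⟨OneCommutes.symm, OneCommutes.symm⟩

/-- `0`-commutativity is symmetric in the two composites. [cite: MochizukiFrdI2008, §0 p.15] -/
theorem zeroCommutes_comm (F : C₁ ⥤ C₂) (G : C₂ ⥤ C₄) (H : C₁ ⥤ C₃) (K : C₃ ⥤ C₄) :
    ZeroCommutes F G H K ↔ ZeroCommutes H K F G :=
  ⟨ZeroCommutes.symm, ZeroCommutes.symm⟩

/-- `1`-commutativity is invariant under replacing each of the four functors by an isomorphic one.
[cite: MochizukiFrdI2008, §0 p.15] -/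
theorem OneCommutes.of_iso {F F' : C₁ ⥤ C₂} {G G' : C₂ ⥤ C₄} {H H' : C₁ ⥤ C₃} {K K' : C₃ ⥤ C₄}
    (h : OneCommutes F G H K) (eF : F ≅ F') (eG : G ≅ G') (eH : H ≅ H') (eK : K ≅ K') :
    OneCommutes F' G' H' K' :=
  ⟨(Functor.isoWhiskerRight eF.symm G' ≪≫ Functor.isoWhiskerLeft F eG.symm) ≪≫ h.some ≪≫
    (Functor.isoWhiskerLeft H eK ≪≫ Functor.isoWhiskerRight eH K')⟩

/-- Horizontal PASTING of `1`-commutative squares: if `(F, G; H, K)` and `(F', G'; G, K')`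
`1`-commute (the right vertical side of the first is the left vertical side of the second), then so
does the outer rectangle `(F ⋙ F', G'; H, K ⋙ K')`. [cite: MochizukiFrdI2008, §0 p.15] -/
theorem OneCommutes.hcomp {F : C₁ ⥤ C₂} {G : C₂ ⥤ C₄} {H : C₁ ⥤ C₃} {K : C₃ ⥤ C₄}
    {F' : C₂ ⥤ C₅} {G' : C₅ ⥤ C₆} {K' : C₄ ⥤ C₆}
    (h : OneCommutes F G H K) (h' : OneCommutes F' G' G K') :
    OneCommutes (F ⋙ F') G' H (K ⋙ K') :=
  ⟨Functor.associator F F' G' ≪≫ Functor.isoWhiskerLeft F h'.some ≪≫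
    (Functor.associator F G K').symm ≪≫ Functor.isoWhiskerRight h.some K' ≪≫
    Functor.associator H K K'⟩

/-- Vertical PASTING of `1`-commutative squares: if `(F, G; H, K)` and `(K, G'; H', K')` `1`-commute
(the bottom of the first is the top of the second), then so does the outer rectangle
`(F, G ⋙ G'; H ⋙ H', K')`. [cite: MochizukiFrdI2008, §0 p.15] -/
theorem OneCommutes.vcomp {F : C₁ ⥤ C₂} {G : C₂ ⥤ C₄} {H : C₁ ⥤ C₃} {K : C₃ ⥤ C₄}
    {G' : C₄ ⥤ C₆} {H' : C₃ ⥤ C₅} {K' : C₅ ⥤ C₆}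
    (h : OneCommutes F G H K) (h' : OneCommutes K G' H' K') :
    OneCommutes F (G ⋙ G') (H ⋙ H') K' :=
  (h.symm.hcomp h'.symm).symm

/-- Horizontal pasting of `0`-commutative squares. [cite: MochizukiFrdI2008, §0 p.15] -/
theorem ZeroCommutes.hcomp {F : C₁ ⥤ C₂} {G : C₂ ⥤ C₄} {H : C₁ ⥤ C₃} {K : C₃ ⥤ C₄}
    {F' : C₂ ⥤ C₅} {G' : C₅ ⥤ C₆} {K' : C₄ ⥤ C₆}
    (h : ZeroCommutes F G H K) (h' : ZeroCommutes F' G' G K') :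
    ZeroCommutes (F ⋙ F') G' H (K ⋙ K') := by
  change F ⋙ (F' ⋙ G') = (H ⋙ K) ⋙ K'
  rw [h', ← h]
  rfl

/-- Vertical pasting of `0`-commutative squares. [cite: MochizukiFrdI2008, §0 p.15] -/
theorem ZeroCommutes.vcomp {F : C₁ ⥤ C₂} {G : C₂ ⥤ C₄} {H : C₁ ⥤ C₃} {K : C₃ ⥤ C₄}
    {G' : C₄ ⥤ C₆} {H' : C₃ ⥤ C₅} {K' : C₅ ⥤ C₆}
    (h : ZeroCommutes F G H K) (h' : ZeroCommutes K G' H' K') :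
    ZeroCommutes F (G ⋙ G') (H ⋙ H') K' :=
  (h.symm.hcomp h'.symm).symm

/-- Precomposition: a `1`-commutative square `(F, G; H, K)` stays `1`-commutative after
precomposing the two left-hand functors with any `L`. [cite: MochizukiFrdI2008, §0 p.15] -/
theorem OneCommutes.precomp {F : C₁ ⥤ C₂} {G : C₂ ⥤ C₄} {H : C₁ ⥤ C₃} {K : C₃ ⥤ C₄}
    (h : OneCommutes F G H K) (L : C₅ ⥤ C₁) : OneCommutes (L ⋙ F) G (L ⋙ H) K :=
  ⟨Functor.associator L F G ≪≫ Functor.isoWhiskerLeft L h.some ≪≫ (Functor.associator L H K).symm⟩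

/-- Postcomposition: a `1`-commutative square `(F, G; H, K)` stays `1`-commutative after
postcomposing the two right-hand functors with any `M`. [cite: MochizukiFrdI2008, §0 p.15] -/
theorem OneCommutes.postcomp {F : C₁ ⥤ C₂} {G : C₂ ⥤ C₄} {H : C₁ ⥤ C₃} {K : C₃ ⥤ C₄}
    (h : OneCommutes F G H K) (M : C₄ ⥤ C₆) : OneCommutes F (G ⋙ M) H (K ⋙ M) :=
  ⟨(Functor.associator F G M).symm ≪≫ Functor.isoWhiskerRight h.some M ≪≫ Functor.associator H K M⟩

/-- Precomposition of a `0`-commutative square. [cite: MochizukiFrdI2008, §0 p.15] -/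
theorem ZeroCommutes.precomp {F : C₁ ⥤ C₂} {G : C₂ ⥤ C₄} {H : C₁ ⥤ C₃} {K : C₃ ⥤ C₄}
    (h : ZeroCommutes F G H K) (L : C₅ ⥤ C₁) : ZeroCommutes (L ⋙ F) G (L ⋙ H) K := by
  change L ⋙ (F ⋙ G) = L ⋙ (H ⋙ K)
  rw [h]

/-- Postcomposition of a `0`-commutative square. [cite: MochizukiFrdI2008, §0 p.15] -/
theorem ZeroCommutes.postcomp {F : C₁ ⥤ C₂} {G : C₂ ⥤ C₄} {H : C₁ ⥤ C₃} {K : C₃ ⥤ C₄}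
    (h : ZeroCommutes F G H K) (M : C₄ ⥤ C₆) : ZeroCommutes F (G ⋙ M) H (K ⋙ M) := by
  change (F ⋙ G) ⋙ M = (H ⋙ K) ⋙ M
  rw [h]

/-- INVERTING THE HORIZONTAL SIDES: if `(Ψ, G; H, E)` `1`-commutes with `Ψ : C₁ ≌ C₂` and
`E : C₃ ≌ C₄` equivalences (`Ψ ⋙ G ≅ H ⋙ E`), then the square of inverses `(Ψ⁻¹, H; G, E⁻¹)`
`1`-commutes (`Ψ⁻¹ ⋙ H ≅ G ⋙ E⁻¹`). [cite: MochizukiFrdI2008, §0 p.15] -/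
theorem OneCommutes.inverse {Ψ : C₁ ≌ C₂} {G : C₂ ⥤ C₄} {H : C₁ ⥤ C₃} {E : C₃ ≌ C₄}
    (h : OneCommutes Ψ.functor G H E.functor) : OneCommutes Ψ.inverse H G E.inverse :=
  ⟨Functor.isoWhiskerLeft Ψ.inverse
      ((Functor.rightUnitor H).symm ≪≫ Functor.isoWhiskerLeft H E.unitIso ≪≫
        (Functor.associator H E.functor E.inverse).symm ≪≫
        Functor.isoWhiskerRight h.some.symm E.inverse ≪≫
        Functor.associator Ψ.functor G E.inverse) ≪≫
    Ψ.invFunIdAssoc (G ⋙ E.inverse)⟩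

/-- A `1`-commutative square whose target category is DISCRETE `0`-commutes (isomorphic functors
into a discrete category are equal). [cite: MochizukiFrdI2008, §0 p.15] -/
theorem OneCommutes.zeroCommutes_of_discrete {α : Type u₄} {F : C₁ ⥤ C₂} {G : C₂ ⥤ Discrete α}
    {H : C₁ ⥤ C₃} {K : C₃ ⥤ Discrete α} (h : OneCommutes F G H K) : ZeroCommutes F G H K :=
  CategoryTheory.Functor.ext (fun X => Discrete.ext (Discrete.eq_of_hom (h.some.hom.app X)))
    (fun _ _ _ => Subsingleton.elim _ _)

end Squares

/-! ### The universal closures of `OneCommutes` / `ZeroCommutes` are refuted (R5) -/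

section SquaresRefuted

/-- TOY INSTANCE.  The square `(𝟭, const ⟨false⟩; 𝟭, const ⟨true⟩)` of functors from the terminal
category `Discrete PUnit` to the two-object discrete category `Discrete Bool` does NOT `1`-commute:
an isomorphism `const ⟨false⟩ ≅ const ⟨true⟩` would give an arrow `⟨false⟩ ⟶ ⟨true⟩` in
`Discrete Bool`. [cite: MochizukiFrdI2008, §0 p.15] -/
theorem not_oneCommutes_const_false_true :
    ¬ OneCommutes (𝟭 (Discrete PUnit.{1})) ((Functor.const _).obj (Discrete.mk false))
      (𝟭 (Discrete PUnit.{1})) ((Functor.const _).obj (Discrete.mk true)) := by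
  rintro ⟨e⟩
  exact Bool.false_ne_true (Discrete.eq_of_hom (e.hom.app ⟨PUnit.unit⟩))

/-- The same square does NOT `0`-commute. [cite: MochizukiFrdI2008, §0 p.15] -/
theorem not_zeroCommutes_const_false_true :
    ¬ ZeroCommutes (𝟭 (Discrete PUnit.{1})) ((Functor.const _).obj (Discrete.mk false))
      (𝟭 (Discrete PUnit.{1})) ((Functor.const _).obj (Discrete.mk true)) :=
  fun h => not_oneCommutes_const_false_true h.oneCommutes

/-- **F-0965, universal closure REFUTED.**  Not every square of functors `1`-commutes (R5: the row
`OneCommutes` is a schema — print's DEFINITION of `1`-commutativity — consumable only at instances).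
[cite: MochizukiFrdI2008, §0 p.15] -/
theorem not_forall_oneCommutes :
    ¬ ∀ (F : Discrete PUnit.{1} ⥤ Discrete PUnit.{1}) (G : Discrete PUnit.{1} ⥤ Discrete Bool)
        (H : Discrete PUnit.{1} ⥤ Discrete PUnit.{1}) (K : Discrete PUnit.{1} ⥤ Discrete Bool),
        OneCommutes F G H K :=
  fun h => not_oneCommutes_const_false_true (h _ _ _ _)

/-- **F-0966, universal closure REFUTED.**  Not every square of functors `0`-commutes.
[cite: MochizukiFrdI2008, §0 p.15] -/
theorem not_forall_zeroCommutes :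
    ¬ ∀ (F : Discrete PUnit.{1} ⥤ Discrete PUnit.{1}) (G : Discrete PUnit.{1} ⥤ Discrete Bool)
        (H : Discrete PUnit.{1} ⥤ Discrete PUnit.{1}) (K : Discrete PUnit.{1} ⥤ Discrete Bool),
        ZeroCommutes F G H K :=
  fun h => not_zeroCommutes_const_false_true (h _ _ _ _)

/-- Every square of functors whose target is a CODISCRETE category `1`-commutes (any two functors
into it are isomorphic, `Codiscrete.natIso`). [cite: MochizukiFrdI2008, §0 p.15] -/
theorem oneCommutes_of_codiscrete {C₁ : Type u₁} [Category.{v₁} C₁] {C₂ : Type u₂}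
    [Category.{v₂} C₂] {C₃ : Type u₃} [Category.{v₃} C₃] {α : Type u₄} (F : C₁ ⥤ C₂)
    (G : C₂ ⥤ Codiscrete α) (H : C₁ ⥤ C₃) (K : C₃ ⥤ Codiscrete α) : OneCommutes F G H K :=
  ⟨Codiscrete.natIso⟩

/-- **`1`-commutativity does NOT imply `0`-commutativity** (the converse of
`ZeroCommutes.oneCommutes` fails, as print's distinction "isomorphic" vs "literally commutes"
intends): the square `(𝟭, const ⟨false⟩; 𝟭, const ⟨true⟩)` into `Codiscrete Bool` `1`-commutes but
its two composites differ on objects. [cite: MochizukiFrdI2008, §0 p.15] -/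
theorem oneCommutes_not_zeroCommutes :
    OneCommutes (𝟭 (Discrete PUnit.{1})) ((Functor.const _).obj (Codiscrete.mk false))
        (𝟭 (Discrete PUnit.{1})) ((Functor.const _).obj (Codiscrete.mk true)) ∧
      ¬ ZeroCommutes (𝟭 (Discrete PUnit.{1})) ((Functor.const _).obj (Codiscrete.mk false))
        (𝟭 (Discrete PUnit.{1})) ((Functor.const _).obj (Codiscrete.mk true)) := by
  refine ⟨oneCommutes_of_codiscrete _ _ _ _, fun h => ?_⟩
  exact Bool.false_ne_true (congrArg Codiscrete.as (Functor.congr_obj h ⟨PUnit.unit⟩))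

/-- Hence `0`-commutativity is STRICTLY stronger than `1`-commutativity: the two notions are not
equivalent as predicates on squares. [cite: MochizukiFrdI2008, §0 p.15] -/
theorem not_forall_oneCommutes_imp_zeroCommutes :
    ¬ ∀ (F : Discrete PUnit.{1} ⥤ Discrete PUnit.{1}) (G : Discrete PUnit.{1} ⥤ Codiscrete Bool)
        (H : Discrete PUnit.{1} ⥤ Discrete PUnit.{1}) (K : Discrete PUnit.{1} ⥤ Codiscrete Bool),
        OneCommutes F G H K → ZeroCommutes F G H K :=
  fun h => oneCommutes_not_zeroCommutes.2 (h _ _ _ _ oneCommutes_not_zeroCommutes.1)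

end SquaresRefuted

/-! ### One-object and one-morphism categories (p. 13) -/

section OneObject

/-! `IsOneObject C` only speaks about the TYPE of objects `C` (the category structure is not an
argument of the declaration), so the lemmas of this subsection carry no `Category` instance. -/

variable {C : Type u}

/-- `C` is (the object type of) a one-object category iff it has a unique element.
[cite: MochizukiFrdI2008, §0 p.13] -/
theorem isOneObject_iff_nonempty_unique : IsOneObject C ↔ Nonempty (Unique C) := by
  rw [isOneObject_iff]
  constructor
  · rintro ⟨A, hA⟩
    exact ⟨⟨⟨A⟩, hA⟩⟩
  · rintro ⟨u⟩
    exact ⟨default, fun B => Subsingleton.elim B default⟩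

/-- `C` is (the object type of) a one-object category iff it is nonempty and subsingleton.
[cite: MochizukiFrdI2008, §0 p.13] -/
theorem isOneObject_iff_nonempty_subsingleton : IsOneObject C ↔ Nonempty C ∧ Subsingleton C := by
  rw [isOneObject_iff_nonempty_unique]
  constructor
  · rintro ⟨u⟩
    exact ⟨⟨default⟩, inferInstance⟩
  · rintro ⟨⟨A⟩, h⟩
    exact ⟨uniqueOfSubsingleton A⟩

/-- A type of objects carrying a `Unique` instance is a one-object category.
[cite: MochizukiFrdI2008, §0 p.13] -/
theorem isOneObject_of_unique [Unique C] : IsOneObject C :=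
  isOneObject_iff_nonempty_unique.mpr ⟨inferInstance⟩

/-- A one-object category has a nonempty type of objects. [cite: MochizukiFrdI2008, §0 p.13] -/
theorem IsOneObject.nonempty (h : IsOneObject C) : Nonempty C :=
  (isOneObject_iff_nonempty_subsingleton.mp h).1

/-- A one-object category has a subsingleton type of objects. [cite: MochizukiFrdI2008, §0 p.13] -/
theorem IsOneObject.subsingleton (h : IsOneObject C) : Subsingleton C :=
  (isOneObject_iff_nonempty_subsingleton.mp h).2

/-- INSTANCE WITNESS: (the object type of) the terminal category `Discrete PUnit` is a one-object
category. [cite: MochizukiFrdI2008, §0 p.13] -/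
theorem isOneObject_discretePUnit : IsOneObject (Discrete PUnit.{w + 1}) :=
  isOneObject_of_unique

/-- INSTANCE WITNESS: (the object type of) Mathlib's one-object category `SingleObj M` of a monoid
`M` — whose endomorphism monoid at the unique object is `M` — is a one-object category.
[cite: MochizukiFrdI2008, §0 p.13] -/
theorem isOneObject_singleObj (M : Type u) : IsOneObject (SingleObj M) :=
  isOneObject_of_unique

/-- The EMPTY category is not a one-object category. [cite: MochizukiFrdI2008, §0 p.13] -/
theorem not_isOneObject_pempty : ¬ IsOneObject (Discrete PEmpty.{w + 1}) :=
  fun h => h.nonempty.elim fun A => PEmpty.elim A.as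

/-- The two-object discrete category is not a one-object category.
[cite: MochizukiFrdI2008, §0 p.13] -/
theorem not_isOneObject_bool : ¬ IsOneObject (Discrete Bool) := by
  intro h
  haveI := h.subsingleton
  exact Bool.false_ne_true
    (congrArg Discrete.as (Subsingleton.elim (⟨false⟩ : Discrete Bool) ⟨true⟩))

/-- **F-2309, universal closure REFUTED.**  Not every category is a one-object category (R5: the
row `IsOneObject` is print's DEFINITION, consumable only at instances; its in-tree producer is
`IsOneMorphism.isOneObject`). [cite: MochizukiFrdI2008, §0 p.13] -/
theorem not_forall_isOneObject : ¬ ∀ D : Type, IsOneObject D :=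
  fun h => not_isOneObject_bool (h (Discrete Bool))

end OneObject

section OneMorphism

variable {C : Type u} [Category.{v} C]

/-- `C` is a one-morphism category iff it is a one-object category all of whose endomorphism
monoids are trivial. [cite: MochizukiFrdI2008, §0 p.13] -/
theorem isOneMorphism_iff_isOneObject_and :
    IsOneMorphism C ↔ IsOneObject C ∧ ∀ (A : C) (f : A ⟶ A), f = 𝟙 A := by
  constructor
  · intro h
    obtain ⟨A, hA, hf⟩ := h.exists_eq
    refine ⟨⟨A, hA⟩, fun B f => ?_⟩
    obtain rfl := hA B
    exact hf f
  · rintro ⟨⟨A, hA⟩, hf⟩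
    exact ⟨A, hA, hf A⟩

/-- INSTANCE WITNESS: the terminal category `Discrete PUnit` is a one-morphism category.
[cite: MochizukiFrdI2008, §0 p.13] -/
theorem isOneMorphism_discretePUnit : IsOneMorphism (Discrete PUnit.{w + 1}) :=
  ⟨default, fun B => Subsingleton.elim B default, fun f => Subsingleton.elim f _⟩

/-- `SingleObj M` is a one-morphism category iff the monoid `M` is trivial; in particular the
one-object category of a nontrivial monoid is a one-object category that is NOT a one-morphism
category (the converse of `IsOneMorphism.isOneObject` fails). [cite: MochizukiFrdI2008, §0 p.13] -/
theorem isOneMorphism_singleObj_iff (M : Type u) [Monoid M] :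
    IsOneMorphism (SingleObj M) ↔ Subsingleton M := by
  rw [isOneMorphism_iff_isOneObject_and]
  constructor
  · rintro ⟨-, h⟩
    exact ⟨fun a b => (h (SingleObj.star M) a).trans (h (SingleObj.star M) b).symm⟩
  · intro hM
    exact ⟨isOneObject_singleObj M, fun A f => Subsingleton.elim (α := M) f _⟩

/-- The one-object category `SingleObj (Multiplicative ℕ)` of the (nontrivial) monoid `(ℕ, +)` is
a one-object category that is NOT a one-morphism category. [cite: MochizukiFrdI2008, §0 p.13] -/
theorem isOneObject_not_isOneMorphism_singleObj_nat :
    IsOneObject (SingleObj (Multiplicative ℕ)) ∧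
      ¬ IsOneMorphism (SingleObj (Multiplicative ℕ)) := by
  refine ⟨isOneObject_singleObj _, fun h => ?_⟩
  haveI := (isOneMorphism_singleObj_iff _).mp h
  exact zero_ne_one (Multiplicative.ofAdd.injective
    (Subsingleton.elim (Multiplicative.ofAdd (0 : ℕ)) (Multiplicative.ofAdd 1)))

end OneMorphism

end Literature.AlgebraicGeometry.Frobenioids
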